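import Literature.MathematicalPhysics.QuantumFieldTheory.ConformalBootstrap3D.MixedBlockCoefficients
import HarnessLib

/-!
# The geometric-mean identity of the mixed-block `z`-series coefficients for general `(Δ₁₂, Δ₃₄)`

`MixedBlockCoefficients` proves `A_{n,j}(a,b) · Π_{00} = Π_{ab} · A_{n,j}(0,0)`
(`hrCoeffAB_mul_doPochFactor`; Dolan–Osborn 2004, eq. (3.11): the `(a,b)`-dependence of the
`z`-series coefficients of `g^{Δ₁₂,Δ₃₄}_{Δ,ℓ}` at `d = 3`, `a = −Δ₁₂/2`, `b = Δ₃₄/2`, sits in the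
Pochhammer factor `Π_{ab} = (λ₁+a)_m (λ₁+b)_m (λ₂−½+a)_{n'} (λ₂−½+b)_{n'}`), and draws the consequence
for the family `b = −a` only (`hrCoeffAB_neg_sq`, `abs_hrCoeffAB_neg_le`).  Since `Π_{ab} = P(a) P(b)`
with ONE polynomial `P`, the same consequence holds for EVERY pair `(a, b)`:

* `doPochFactor_mul_self_eq` — `Π_{ab}² = Π_{aa} Π_{bb}`;
* `hrCoeffAB_sq_eq_self_mul_self` — `A_{n,j}(a,b)² = A_{n,j}(a,a) · A_{n,j}(b,b)` wherever
  `Π_{00}(n,j) ≠ 0` (all `Δ` strictly above the unitarity bound, `Δ ≠ 1` if `ℓ = 0`);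
* `abs_hrCoeffAB_le_weighted` — the weighted AM–GM form
  `|A_{n,j}(a,b)| ≤ (t A_{n,j}(a,a) + t⁻¹ A_{n,j}(b,b))/2` for every `t > 0` (both right-hand
  coefficients are `≥ 0`, `hrCoeffAB_self_nonneg`), and `abs_hrCoeffAB_le_half_add` (`t = 1`);
* `hrCoeffAB_eq_doPochFactor_mul_div` — the closed form `A(a,b) = Π_{ab} A(0,0)/Π_{00}`, with the sign
  rules `hrCoeffAB_nonneg_of_doPochFactor_nonneg` / `hrCoeffAB_nonpos_of_doPochFactor_nonpos`.

USE (planning note, O(2) three-scalar scan): the `2 × 2` sectors `1`, `2⁺` of the O(2) system carry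
OFF-DIAGONAL blocks `g^{Δ₁₂,Δ₃₄}` with `|Δ₁₂| ≠ |Δ₃₄|` (e.g. `F^{φφ,st}`: `Δ₁₂ = 0`, `Δ₃₄ = Δ_s − Δ_t`;
`F^{φs,φt}`: `Δ₁₂ = Δ_φ − Δ_s`, `Δ₃₄ = Δ_φ − Δ_t`), whose coefficient series are sign-indefinite; the
identity encloses them termwise by the two reflection-positive series `A(a,a)`, `A(b,b)`.
Pure algebra on the tree's definitions; no numerics, no new definitions.

References: Dolan–Osborn, Nucl. Phys. B 678 (2004) 491, §3 eq. (3.11) (`DolanOsborn2004`);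
Hogervorst–Rychkov, Phys. Rev. D 87 (2013) 106004, §3 eqs. (3.6)–(3.9) (`HogervorstRychkov2013`).
-/

namespace Literature.MathematicalPhysics.QuantumFieldTheory.ConformalBootstrap3D

open Finset

/-- **`Π_{ab} · Π_{ab} = Π_{aa} · Π_{bb}`** for every `(a, b)`: each factor `(x+a)(x+b)` squared is
`(x+a)² (x+b)²`. [cite: DolanOsborn2004, §3 eq. (3.11)] -/
theorem doPochFactor_mul_self_eq (a b Δ : ℝ) (ℓ n j : ℕ) :
    doPochFactor a b Δ ℓ n j * doPochFactor a b Δ ℓ n j =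
      doPochFactor a a Δ ℓ n j * doPochFactor b b Δ ℓ n j := by
  unfold doPochFactor
  rw [mul_mul_mul_comm, ← Finset.prod_mul_distrib, ← Finset.prod_mul_distrib, mul_mul_mul_comm,
    ← Finset.prod_mul_distrib, ← Finset.prod_mul_distrib]
  congr 1
  · exact Finset.prod_congr rfl fun i _ => by ring
  · exact Finset.prod_congr rfl fun i _ => by ring

/-- **Geometric-mean identity, cross-multiplied form**:
`(A_{n,j}(a,b) Π_{00})² = (A_{n,j}(a,a) Π_{00}) (A_{n,j}(b,b) Π_{00})`. [cite: DolanOsborn2004, §3 eq. (3.11)] -/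
theorem hrCoeffAB_mul_doPochFactor_mul_self (a b Δ : ℝ) (ℓ n j : ℕ) :
    (hrCoeffAB a b Δ ℓ n j * doPochFactor 0 0 Δ ℓ n j) *
        (hrCoeffAB a b Δ ℓ n j * doPochFactor 0 0 Δ ℓ n j) =
      (hrCoeffAB a a Δ ℓ n j * doPochFactor 0 0 Δ ℓ n j) *
        (hrCoeffAB b b Δ ℓ n j * doPochFactor 0 0 Δ ℓ n j) := by
  rw [hrCoeffAB_mul_doPochFactor, hrCoeffAB_mul_doPochFactor, hrCoeffAB_mul_doPochFactor]
  have h := doPochFactor_mul_self_eq a b Δ ℓ n j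
  linear_combination (hrCoeff Δ ℓ n j * hrCoeff Δ ℓ n j) * h

/-- **`A_{n,j}(a,b)² = A_{n,j}(a,a) · A_{n,j}(b,b)`** wherever `Π_{00}(n,j) ≠ 0`: the coefficient of a
general ordering is, up to sign, the geometric mean of two reflection-positive ones.
[cite: DolanOsborn2004, §3 eq. (3.11)] -/
theorem hrCoeffAB_sq_eq_self_mul_self {a b Δ : ℝ} {ℓ n j : ℕ} (h : doPochFactor 0 0 Δ ℓ n j ≠ 0) :
    hrCoeffAB a b Δ ℓ n j ^ 2 = hrCoeffAB a a Δ ℓ n j * hrCoeffAB b b Δ ℓ n j := by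
  have h2 : doPochFactor 0 0 Δ ℓ n j * doPochFactor 0 0 Δ ℓ n j ≠ 0 := mul_ne_zero h h
  have key := hrCoeffAB_mul_doPochFactor_mul_self a b Δ ℓ n j
  have : (hrCoeffAB a b Δ ℓ n j ^ 2 - hrCoeffAB a a Δ ℓ n j * hrCoeffAB b b Δ ℓ n j) *
      (doPochFactor 0 0 Δ ℓ n j * doPochFactor 0 0 Δ ℓ n j) = 0 := by
    linear_combination key
  rcases mul_eq_zero.mp this with h0 | h0
  · linarith
  · exact absurd h0 h2

/-- **Weighted AM–GM enclosure**: strictly above the unitarity bound (`Δ ≠ 1` if `ℓ = 0`), for every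
`t > 0`, `|A_{n,j}(a,b)| ≤ (t A_{n,j}(a,a) + t⁻¹ A_{n,j}(b,b))/2`. [cite: DolanOsborn2004, §3 eq. (3.11)] -/
theorem abs_hrCoeffAB_le_weighted {a b Δ : ℝ} {ℓ : ℕ} (hΔ : unitarityBound3D ℓ < Δ)
    (h1 : ℓ = 0 → Δ ≠ 1) {t : ℝ} (ht : 0 < t) (n j : ℕ) :
    |hrCoeffAB a b Δ ℓ n j| ≤ (t * hrCoeffAB a a Δ ℓ n j + t⁻¹ * hrCoeffAB b b Δ ℓ n j) / 2 := by
  have hP := (doPochFactor_zero_zero_pos hΔ h1 n j).ne'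
  have hsq := hrCoeffAB_sq_eq_self_mul_self (a := a) (b := b) hP
  have hp := hrCoeffAB_self_nonneg a hΔ n j
  have hq := hrCoeffAB_self_nonneg b hΔ n j
  set x := hrCoeffAB a b Δ ℓ n j
  set p := hrCoeffAB a a Δ ℓ n j
  set q := hrCoeffAB b b Δ ℓ n j
  have htinv : 0 < t⁻¹ := inv_pos.mpr ht
  have hm : 0 ≤ (t * p + t⁻¹ * q) / 2 := by positivity
  have hone : t * t⁻¹ = 1 := mul_inv_cancel₀ ht.ne'
  have hm2 : x ^ 2 ≤ ((t * p + t⁻¹ * q) / 2) ^ 2 := by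
    rw [hsq]
    nlinarith [sq_nonneg (t * p - t⁻¹ * q), hone]
  rw [abs_le]
  constructor
  · nlinarith [hm2, hm, sq_nonneg (x + (t * p + t⁻¹ * q) / 2)]
  · nlinarith [hm2, hm, sq_nonneg (x - (t * p + t⁻¹ * q) / 2)]

/-- **AM–GM enclosure** (`t = 1`): `|A_{n,j}(a,b)| ≤ (A_{n,j}(a,a) + A_{n,j}(b,b))/2`; the case `b = −a`
is the tree's `abs_hrCoeffAB_neg_le`. [cite: DolanOsborn2004, §3 eq. (3.11)] -/
theorem abs_hrCoeffAB_le_half_add {a b Δ : ℝ} {ℓ : ℕ} (hΔ : unitarityBound3D ℓ < Δ)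
    (h1 : ℓ = 0 → Δ ≠ 1) (n j : ℕ) :
    |hrCoeffAB a b Δ ℓ n j| ≤ (hrCoeffAB a a Δ ℓ n j + hrCoeffAB b b Δ ℓ n j) / 2 := by
  simpa using abs_hrCoeffAB_le_weighted (a := a) (b := b) hΔ h1 one_pos n j

/-- **Closed form**: `A_{n,j}(a,b) = Π_{ab}(n,j) · A_{n,j}(0,0) / Π_{00}(n,j)` wherever `Π_{00} ≠ 0`
(`A(0,0)` = Hogervorst–Rychkov's `hrCoeff`). [cite: DolanOsborn2004, §3 eq. (3.11)]
[cite: HogervorstRychkov2013, §3 eqs. (3.6)–(3.9)] -/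
theorem hrCoeffAB_eq_doPochFactor_mul_div {a b Δ : ℝ} {ℓ n j : ℕ}
    (h : doPochFactor 0 0 Δ ℓ n j ≠ 0) :
    hrCoeffAB a b Δ ℓ n j = doPochFactor a b Δ ℓ n j * hrCoeff Δ ℓ n j / doPochFactor 0 0 Δ ℓ n j := by
  rw [eq_div_iff h]
  exact hrCoeffAB_mul_doPochFactor a b Δ ℓ n j

/-- **Sign rule**: strictly above the bound (`Δ ≠ 1` if `ℓ = 0`), `Π_{ab}(n,j) ≥ 0 ⇒ A_{n,j}(a,b) ≥ 0`.
[cite: DolanOsborn2004, §3 eq. (3.11)] [cite: HogervorstRychkov2013, §3 eqs. (3.6)–(3.9)] -/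
theorem hrCoeffAB_nonneg_of_doPochFactor_nonneg {a b Δ : ℝ} {ℓ : ℕ} (hΔ : unitarityBound3D ℓ < Δ)
    (h1 : ℓ = 0 → Δ ≠ 1) {n j : ℕ} (hPi : 0 ≤ doPochFactor a b Δ ℓ n j) :
    0 ≤ hrCoeffAB a b Δ ℓ n j := by
  have hP := doPochFactor_zero_zero_pos hΔ h1 n j
  rw [hrCoeffAB_eq_doPochFactor_mul_div hP.ne']
  exact div_nonneg (mul_nonneg hPi (hrCoeff_nonneg hΔ n j)) hP.le

/-- **Sign rule**: strictly above the bound (`Δ ≠ 1` if `ℓ = 0`), `Π_{ab}(n,j) ≤ 0 ⇒ A_{n,j}(a,b) ≤ 0`.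
[cite: DolanOsborn2004, §3 eq. (3.11)] [cite: HogervorstRychkov2013, §3 eqs. (3.6)–(3.9)] -/
theorem hrCoeffAB_nonpos_of_doPochFactor_nonpos {a b Δ : ℝ} {ℓ : ℕ} (hΔ : unitarityBound3D ℓ < Δ)
    (h1 : ℓ = 0 → Δ ≠ 1) {n j : ℕ} (hPi : doPochFactor a b Δ ℓ n j ≤ 0) :
    hrCoeffAB a b Δ ℓ n j ≤ 0 := by
  have hP := doPochFactor_zero_zero_pos hΔ h1 n j
  rw [hrCoeffAB_eq_doPochFactor_mul_div hP.ne']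
  exact div_nonpos_of_nonpos_of_nonneg (mul_nonpos_of_nonpos_of_nonneg hPi (hrCoeff_nonneg hΔ n j)) hP.le

/-- **Product enclosure for a quadratic form** (the use in a `2 × 2` sector): for reals `u, v` and
`t > 0`, `2 |u v A_{n,j}(a,b)| ≤ t u² A_{n,j}(a,a) + t⁻¹ v² A_{n,j}(b,b)`. [cite: DolanOsborn2004, §3 eq. (3.11)] -/
theorem two_mul_abs_mul_hrCoeffAB_le {a b Δ : ℝ} {ℓ : ℕ} (hΔ : unitarityBound3D ℓ < Δ)
    (h1 : ℓ = 0 → Δ ≠ 1) {t : ℝ} (ht : 0 < t) (u v : ℝ) (n j : ℕ) :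
    2 * |u * v * hrCoeffAB a b Δ ℓ n j| ≤
      t * u ^ 2 * hrCoeffAB a a Δ ℓ n j + t⁻¹ * v ^ 2 * hrCoeffAB b b Δ ℓ n j := by
  have hP := (doPochFactor_zero_zero_pos hΔ h1 n j).ne'
  have hsq := hrCoeffAB_sq_eq_self_mul_self (a := a) (b := b) hP
  have hp := hrCoeffAB_self_nonneg a hΔ n j
  have hq := hrCoeffAB_self_nonneg b hΔ n j
  set x := hrCoeffAB a b Δ ℓ n j
  set p := hrCoeffAB a a Δ ℓ n j
  set q := hrCoeffAB b b Δ ℓ n j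
  have htinv : 0 < t⁻¹ := inv_pos.mpr ht
  have hone : t * t⁻¹ = 1 := mul_inv_cancel₀ ht.ne'
  -- `(u v x)² = u² v² p q ≤ ((t u² p + t⁻¹ v² q)/2)²`
  have hm : 0 ≤ t * u ^ 2 * p + t⁻¹ * v ^ 2 * q := by positivity
  have hm2 : (u * v * x) ^ 2 ≤ ((t * u ^ 2 * p + t⁻¹ * v ^ 2 * q) / 2) ^ 2 := by
    have : (u * v * x) ^ 2 = u ^ 2 * v ^ 2 * (p * q) := by rw [← hsq]; ring
    rw [this]
    nlinarith [sq_nonneg (t * u ^ 2 * p - t⁻¹ * v ^ 2 * q), hone]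
  have hab : |u * v * x| ≤ (t * u ^ 2 * p + t⁻¹ * v ^ 2 * q) / 2 := by
    rw [abs_le]
    constructor
    · nlinarith [hm2, hm, sq_nonneg (u * v * x + (t * u ^ 2 * p + t⁻¹ * v ^ 2 * q) / 2)]
    · nlinarith [hm2, hm, sq_nonneg (u * v * x - (t * u ^ 2 * p + t⁻¹ * v ^ 2 * q) / 2)]
  linarith

end Literature.MathematicalPhysics.QuantumFieldTheory.ConformalBootstrap3D
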